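import Literature.Probability.LatticeModels.KCFamilyBounds
import Literature.Probability.LatticeModels.KCObservableGaugedBounds
import HarnessLib

/-!
# The gauged chart: lattice hypotheses of the continuum chain for the local branch across the seam

Topic `Literature/Probability/LatticeModels`; companion of `KCFamilyBounds.lean` (plain branch off
the seam ray). Near the seam but away from the vertical ray going down from `a` the local branch
`G = seamChiS p₀ · kcObs` (`SeamGauge.lean`, `KCObservableGaugedBounds.lean`) is an honest
s-holomorphic bond function, so the second chart of the double cover of `Ω ∖ {a}`
(Chelkak–Hongler–Izyurov 2015, Prop. 2.4: `F_δ` has monodromy `-1` around `a`) is obtained from the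
gauged bulk bounds:

* `downRay a` (closed vertical ray from slightly above `a` downwards), `sourcePlaq δ a` (the source
  plaquette `p₀ = v₀ - e₀ - e₁`, `v₀ = nearestSite δ a`), `KCFamily.gobs` (the gauged branch);
* `KCFamily.VSign` — the extra clause: eventually, near compacts off `a`, the vertical lower sign
  has the values dictated by the source (`+1` exactly on the seam; for concrete families this is
  `vLowSign_empty_of_source`);
* `not_ray_of_near` (sites near a compact off the down-ray are off the lattice down-ray, eventually);
* **`IsNice.latticeSupHyp_gauged`**, **`IsNice.latticeLipHyp_gauged`**: `LatticeSupHyp` for `obs`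
  (norms are gauge-invariant) and `LatticeLipHyp` for `gobs` on compacts `K ⊆ Ω ∖ downRay a`.

Everything is proved; no named fact.

## References

* D. Chelkak, C. Hongler, K. Izyurov, Ann. of Math. 181 (2015): Prop. 2.4, Thm 3.12
  [ChelkakHonglerIzyurovAnnals2015].
-/

noncomputable section

namespace Literature.Probability.LatticeModels

open Filter _root_.Topology Metric Set Finset SimpleGraph

/-- **The down-ray**: the closed vertical ray from one unit above `a` downwards. [cite: ChelkakHonglerIzyurovAnnals2015, §3.2] -/
def downRay (a : ℂ) : Set ℂ := {z | z.re = a.re ∧ z.im ≤ a.im + 1}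

/-- The down-ray is closed. [folklore] -/
theorem isClosed_downRay (a : ℂ) : IsClosed (downRay a) := by
  have h1 : IsClosed {z : ℂ | z.re = a.re} := isClosed_eq Complex.continuous_re continuous_const
  have h2 : IsClosed {z : ℂ | z.im ≤ a.im + 1} := isClosed_le Complex.continuous_im continuous_const
  exact h1.inter h2

/-- `a` lies on its down-ray. [folklore] -/
theorem mem_downRay_self (a : ℂ) : a ∈ downRay a := ⟨rfl, by simp⟩

/-- **The source plaquette** at mesh `δ`: `p₀ = v₀ - e₀ - e₁`, `v₀ = nearestSite δ a`, so that
`v₀ = p₀ + e₀ + e₁` as in `SlitPlaneSourceMatching.lean`. [cite: ChelkakHonglerIzyurovAnnals2015, §3.2] -/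
def sourcePlaq (δ : ℝ) (a : ℂ) : Site 2 := nearestSite δ a + cornerUnit 2 + cornerUnit 3

/-- Coordinates of the source plaquette. [folklore] -/
theorem sourcePlaq_apply (δ : ℝ) (a : ℂ) : (sourcePlaq δ a) 0 = (nearestSite δ a) 0 - 1 ∧ (sourcePlaq δ a) 1 = (nearestSite δ a) 1 - 1 := by
  simp [sourcePlaq, cornerUnit]; omega

namespace KCFamily

variable (𝓕 : KCFamily) (Ω : Set ℂ) (a : ℂ)

/-- The gauged branch of the spin fermion of the data. [cite: ChelkakHonglerIzyurovAnnals2015, Prop. 2.4] -/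
def gobs (δ : ℝ) : MedialVertex → ℂ := seamGaugeS (𝓕.obs Ω δ) (sourcePlaq δ a)

/-- **The sign-value clause** (a hypothesis structure, like `IsNice`): eventually in the mesh, near
every compact off `a`, the vertical lower sign of the cut system is `+1` exactly on the seam of the
source plaquette. [cite: ChelkakHonglerIzyurovAnnals2015, Prop. 2.4] -/
structure VSign : Prop where
  sign : ∀ K ⊆ Ω \ {a}, IsCompact K → ∃ ρ > 0, ∀ᶠ δ in 𝓝[>] (0 : ℝ), ∀ x y : Site 2, meshPoint δ x ∈ K →
    dist (meshPoint δ y) (meshPoint δ x) ≤ ρ →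
      vLowSign ∅ (𝓕.cut δ) (y + cornerUnit 3) =
        if ((y + cornerUnit 3) 1 = (sourcePlaq δ a) 1 ∧ (sourcePlaq δ a) 0 < (y + cornerUnit 3) 0) then 1 else -1

variable {𝓕 Ω a}

/-- `‖gobs‖ = ‖obs‖`. [folklore] -/
theorem norm_gobs (δ : ℝ) (e : MedialVertex) : ‖𝓕.gobs Ω a δ e‖ = ‖𝓕.obs Ω δ e‖ := norm_seamGaugeS _ _ _

/-- **Sites near a compact off the down-ray are off the lattice down-ray**, eventually: if
`cthickening r K ⊆ (downRay a)ᶜ` then for `δ` small, every site `y` with mesh point within `r/2`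
of a point of `K` satisfies `¬(y 0 = p₀ 0 + 1 ∧ y 1 ≤ p₀ 1 + 1)`. [folklore] -/
theorem not_ray_of_near {K : Set ℂ} {r : ℝ} (hr : 0 < r) (hK : cthickening r K ⊆ (downRay a)ᶜ) :
    ∀ᶠ δ in 𝓝[>] (0 : ℝ), ∀ x y : Site 2, meshPoint δ x ∈ K → dist (meshPoint δ y) (meshPoint δ x) ≤ r / 2 →
      ¬(y 0 = (sourcePlaq δ a) 0 + 1 ∧ y 1 ≤ (sourcePlaq δ a) 1 + 1) := by
  have hsmall : ∀ᶠ δ in 𝓝[>] (0 : ℝ), δ < min (r / 8) 1 := nhdsWithin_le_nhds (Iio_mem_nhds (by positivity))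
  have h3 : ∀ᶠ δ in 𝓝[>] (0 : ℝ), 0 < δ := self_mem_nhdsWithin
  filter_upwards [hsmall, h3] with δ hδs hδ0 x y hx hxy ⟨hy0, hy1⟩
  have hδr : δ < r / 8 := lt_of_lt_of_le hδs (min_le_left _ _)
  have hδ1 : δ < 1 := lt_of_lt_of_le hδs (min_le_right _ _)
  obtain ⟨hp0, hp1⟩ := sourcePlaq_apply δ a
  -- the point of the down-ray next to `meshPoint δ y`
  set q : ℂ := ⟨a.re, min (δ * y 1) (a.im + 1)⟩ with hq
  have hqray : q ∈ downRay a := ⟨rfl, min_le_right _ _⟩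
  have hv := dist_meshPoint_nearestSite_le hδ0 a
  rw [Complex.dist_eq] at hv
  have hvre := (Complex.abs_re_le_norm (meshPoint δ (nearestSite δ a) - a)).trans hv
  have hvim := (Complex.abs_im_le_norm (meshPoint δ (nearestSite δ a) - a)).trans hv
  simp only [Complex.sub_re, Complex.sub_im, meshPoint_re, meshPoint_im] at hvre hvim
  have hy0' : (y 0 : ℝ) = (nearestSite δ a) 0 := by exact_mod_cast (show y 0 = (nearestSite δ a) 0 by omega)
  have hy1' : (y 1 : ℝ) ≤ (nearestSite δ a) 1 := by exact_mod_cast (show y 1 ≤ (nearestSite δ a) 1 by omega)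
  -- `dist (meshPoint δ y) q ≤ 2δ`
  have hdq : dist (meshPoint δ y) q ≤ 2 * δ := by
    rw [Complex.dist_eq]
    refine (Complex.norm_le_abs_re_add_abs_im _).trans ?_
    simp only [Complex.sub_re, Complex.sub_im, meshPoint_re, meshPoint_im, hq]
    have e1 : |δ * (y 0 : ℝ) - a.re| ≤ δ := by rw [hy0']; exact hvre
    have e2 : |δ * (y 1 : ℝ) - min (δ * (y 1 : ℝ)) (a.im + 1)| ≤ δ := by
      rcases le_total (δ * (y 1 : ℝ)) (a.im + 1) with hle | hle
      · rw [min_eq_left hle, sub_self, abs_zero]; exact hδ0.le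
      · rw [min_eq_right hle, abs_of_nonneg (by linarith)]
        have : δ * (y 1 : ℝ) ≤ δ * (nearestSite δ a) 1 := mul_le_mul_of_nonneg_left hy1' hδ0.le
        rw [abs_le] at hvim
        nlinarith [hvim.2]
    linarith
  -- hence `q ∈ cthickening r K`, contradiction
  have hqK : q ∈ cthickening r K := by
    refine Metric.mem_cthickening_of_dist_le q (meshPoint δ x) r K hx ?_
    calc dist q (meshPoint δ x) ≤ dist q (meshPoint δ y) + dist (meshPoint δ y) (meshPoint δ x) := dist_triangle _ _ _
      _ ≤ 2 * δ + r / 2 := by rw [_root_.dist_comm]; exact add_le_add hdq hxy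
      _ ≤ r := by linarith
  exact hK hqK hqray

/-- **The gauged bulk hypotheses on a lattice ball**, from the clauses. [cite: ChelkakHonglerIzyurovAnnals2015, §3.3] -/
theorem kcBulkG_of_clauses {δ : ℝ} (hδ : 0 ≤ δ) {x : Site 2} {R : ℤ} {ρ : ℝ} (hR : δ * (2 * R) ≤ ρ)
    (hbulk : ∀ y : Site 2, dist (meshPoint δ y) (meshPoint δ x) ≤ ρ →
      y ∈ 𝓕.Λ δ ∧ edgeBoundary (discreteDomainGraph Ω δ) {y} = Finset.univ.image (fun k : Fin 4 => cSrc (y, k)) ∧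
      (∀ k : Fin 4, faceAt y k ∈ 𝓕.P δ) ∧
      (∀ j : Fin 4, s(y + cornerOff j, y + cornerOff j + cornerUnit j) ∈ edgesTouching (discreteDomainGraph Ω δ) (𝓕.Λ δ)) ∧
      Odd #(Finset.univ.filter fun j : Fin 4 => s(y + cornerOff j, y + cornerOff j + cornerUnit j) ∈ 𝓕.cut δ y))
    (hV : ∀ y : Site 2, dist (meshPoint δ y) (meshPoint δ x) ≤ ρ →
      vLowSign ∅ (𝓕.cut δ) (y + cornerUnit 3) =
        if ((y + cornerUnit 3) 1 = (sourcePlaq δ a) 1 ∧ (sourcePlaq δ a) 0 < (y + cornerUnit 3) 0) then 1 else -1)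
    (hray : ∀ y : Site 2, dist (meshPoint δ y) (meshPoint δ x) ≤ ρ → ¬(y 0 = (sourcePlaq δ a) 0 + 1 ∧ y 1 ≤ (sourcePlaq δ a) 1 + 1)) :
    KCBulkG (discreteDomainGraph Ω δ) (𝓕.Λ δ) (𝓕.cut δ) (𝓕.P δ) (sourcePlaq δ a) (latticeBall x R) := by
  have hin : ∀ y ∈ latticeBall x R, dist (meshPoint δ y) (meshPoint δ x) ≤ ρ := fun y hy =>
    (dist_meshPoint_le_of_mem_latticeBall hδ hy).trans hR
  exact ⟨fun y hy => (hbulk y (hin y hy)).1, fun y hy => (hbulk y (hin y hy)).2.1, fun y hy => (hbulk y (hin y hy)).2.2.1,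
    fun y hy => (hbulk y (hin y hy)).2.2.2.1, fun y hy => (hbulk y (hin y hy)).2.2.2.2, fun y hy => hV y (hin y hy),
    fun y hy => hray y (hin y hy)⟩

/-- **The lattice sup hypothesis on compacts off the down-ray** (for the plain observable; norms are
gauge-invariant). [cite: ChelkakHonglerIzyurovAnnals2015, Thm 3.12 (3.12)] -/
theorem IsNice.latticeSupHyp_gauged (h : 𝓕.IsNice Ω a) (hVs : 𝓕.VSign Ω a) (hΩ : IsOpen Ω) {K : Set ℂ} (hK : IsCompact K)
    (hKΩ : K ⊆ Ω \ downRay a) :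
    ∃ ρ > 0, ∃ M > 0, LatticeSupHyp (𝓕.obs Ω) K ρ (kcSupConst M) := by
  have hopen : IsOpen (Ω \ downRay a) := hΩ.sdiff (isClosed_downRay a)
  obtain ⟨r, hr, hrΩ⟩ := hK.exists_cthickening_subset_open hopen hKΩ
  have hrray : cthickening r K ⊆ (downRay a)ᶜ := fun z hz => (hrΩ hz).2
  set K₁ := cthickening (r / 4) K with hK₁
  have hK₁c : IsCompact K₁ := hK.cthickening
  have hK₁sub : K₁ ⊆ cthickening r K := cthickening_mono (by linarith) K
  have hK₁a : K₁ ⊆ Ω \ {a} := fun z hz => ⟨(hrΩ (hK₁sub hz)).1, fun hza => (hrΩ (hK₁sub hz)).2 (hza ▸ mem_downRay_self a)⟩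
  obtain ⟨ρb, hρb, hbulk⟩ := h.bulk K₁ hK₁a hK₁c
  obtain ⟨ρv, hρv, hV⟩ := hVs.sign K₁ hK₁a hK₁c
  obtain ⟨M, hM, hbound⟩ := h.hbound K₁ hK₁a hK₁c
  have hray := not_ray_of_near (a := a) hr hrray
  set ρ := min (r / 4) (min ρb ρv) with hρ
  have hρ0 : 0 < ρ := by positivity
  have hρr : ρ ≤ r / 4 := min_le_left _ _
  have hρb' : ρ ≤ ρb := (min_le_right _ _).trans (min_le_left _ _)
  have hρv' : ρ ≤ ρv := (min_le_right _ _).trans (min_le_right _ _)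
  refine ⟨ρ / 2, by positivity, M, hM, ?_⟩
  have h3 : ∀ᶠ δ in 𝓝[>] (0 : ℝ), 0 < δ := self_mem_nhdsWithin
  filter_upwards [h.adj, h.cuts, h.prim, hbulk, hV, hbound, hray, h3] with δ hadj hcuts hprim hb hv hbd hry hδ0 x hx p hp hsize y hy i hi
  set c : Site 2 := ![x 0 - 2 * (4 * p : ℕ), x 1 - 2 * (4 * p : ℕ)] with hcdef
  have hcx : boxCentre c (4 * p) = x := boxCentre_sub x (4 * p)
  have hxK₁ : meshPoint δ x ∈ K₁ := self_subset_cthickening K hx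
  have hR : δ * (2 * ((2 * (2 * (4 * (p : ℕ))) + 3 : ℕ) : ℤ)) ≤ ρ := by
    push_cast
    nlinarith [hsize, hδ0.le]
  have hKb := kcBulkG_of_clauses (𝓕 := 𝓕) (Ω := Ω) (a := a) hδ0.le (x := x) (R := ((2 * (2 * (4 * p)) + 3 : ℕ) : ℤ)) hR
    (fun y hy => hb x y hxK₁ (hy.trans hρb')) (fun y hy => hv x y hxK₁ (hy.trans hρv'))
    (fun y hy => hry x y hx (hy.trans (by linarith)))
  rw [← hcx] at hKb
  have hMw : ∀ y ∈ latticeBall (boxCentre c (4 * p)) (2 * (2 * (4 * p)) + 1), |𝓕.Hw δ y| ≤ M := by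
    intro y hy
    rw [hcx] at hy
    have hd : dist (meshPoint δ y) (meshPoint δ x) ≤ ρ := by
      refine (dist_meshPoint_le_of_mem_latticeBall hδ0.le hy).trans (le_trans ?_ hR)
      gcongr; push_cast; linarith
    exact (hbd y (Metric.mem_cthickening_of_dist_le _ _ _ _ hx (hd.trans hρr))).1
  have hMb : ∀ y ∈ latticeBall (boxCentre c (4 * p)) (2 * (2 * (4 * p)) + 1), |𝓕.Hb δ y| ≤ M := by
    intro y hy
    rw [hcx] at hy
    have hd : dist (meshPoint δ y) (meshPoint δ x) ≤ ρ := by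
      refine (dist_meshPoint_le_of_mem_latticeBall hδ0.le hy).trans (le_trans ?_ hR)
      gcongr; push_cast; linarith
    exact (hbd y (Metric.mem_cthickening_of_dist_le _ _ _ _ hx (hd.trans hρr))).2
  have hyb : y ∈ latticeBall (boxCentre c (4 * p)) p := by rw [hcx]; exact hy
  have hKb' : KCBulkG (discreteDomainGraph Ω δ) (𝓕.Λ δ) (𝓕.cut δ) (𝓕.P δ) (sourcePlaq δ a)
      (latticeBall (boxCentre c (4 * p)) (2 * (2 * (4 * p)) + 3)) := by
    convert hKb using 2
    push_cast; ring
  exact norm_kcObs_le_of_gaugedBulk hprim hcuts hadj (discreteDomainGraph_le_zdGraph Ω δ) hp hKb' hM hMw hMb hyb hi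

/-- **The lattice Lipschitz hypothesis for the gauged branch on compacts off the down-ray.** [cite: ChelkakHonglerIzyurovAnnals2015, Thm 3.12 (3.13)] -/
theorem IsNice.latticeLipHyp_gauged (h : 𝓕.IsNice Ω a) (hVs : 𝓕.VSign Ω a) (hΩ : IsOpen Ω) {K : Set ℂ} (hK : IsCompact K)
    (hKΩ : K ⊆ Ω \ downRay a) :
    ∃ ρ > 0, ∃ M > 0, LatticeLipHyp (𝓕.gobs Ω a) K ρ (8 * topGradConst * kcSupConst M) := by
  have hopen : IsOpen (Ω \ downRay a) := hΩ.sdiff (isClosed_downRay a)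
  obtain ⟨r, hr, hrΩ⟩ := hK.exists_cthickening_subset_open hopen hKΩ
  have hrray : cthickening r K ⊆ (downRay a)ᶜ := fun z hz => (hrΩ hz).2
  set K₁ := cthickening (r / 4) K with hK₁
  have hK₁c : IsCompact K₁ := hK.cthickening
  have hK₁sub : K₁ ⊆ cthickening r K := cthickening_mono (by linarith) K
  have hK₁a : K₁ ⊆ Ω \ {a} := fun z hz => ⟨(hrΩ (hK₁sub hz)).1, fun hza => (hrΩ (hK₁sub hz)).2 (hza ▸ mem_downRay_self a)⟩
  obtain ⟨ρb, hρb, hbulk⟩ := h.bulk K₁ hK₁a hK₁c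
  obtain ⟨ρv, hρv, hV⟩ := hVs.sign K₁ hK₁a hK₁c
  obtain ⟨M, hM, hbound⟩ := h.hbound K₁ hK₁a hK₁c
  have hray := not_ray_of_near (a := a) hr hrray
  set ρ := min (r / 4) (min ρb ρv) with hρ
  have hρ0 : 0 < ρ := by positivity
  have hρr : ρ ≤ r / 4 := min_le_left _ _
  have hρb' : ρ ≤ ρb := (min_le_right _ _).trans (min_le_left _ _)
  have hρv' : ρ ≤ ρv := (min_le_right _ _).trans (min_le_right _ _)
  refine ⟨ρ / 2, by positivity, M, hM, ?_⟩
  have h3 : ∀ᶠ δ in 𝓝[>] (0 : ℝ), 0 < δ := self_mem_nhdsWithin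
  filter_upwards [h.adj, h.cuts, h.prim, hbulk, hV, hbound, hray, h3] with δ hadj hcuts hprim hb hv hbd hry hδ0 x hx q hq hsize y hy j
  set c : Site 2 := ![x 0 - 2 * (4 * (2 * q) : ℕ), x 1 - 2 * (4 * (2 * q) : ℕ)] with hcdef
  have hcx : boxCentre c (4 * (2 * q)) = x := boxCentre_sub x (4 * (2 * q))
  have hxK₁ : meshPoint δ x ∈ K₁ := self_subset_cthickening K hx
  have hR : δ * (2 * ((2 * (2 * (4 * (2 * q))) + 3 : ℕ) : ℤ)) ≤ ρ := by
    push_cast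
    nlinarith [hsize, hδ0.le]
  have hKb := kcBulkG_of_clauses (𝓕 := 𝓕) (Ω := Ω) (a := a) hδ0.le (x := x) (R := ((2 * (2 * (4 * (2 * q))) + 3 : ℕ) : ℤ)) hR
    (fun y hy => hb x y hxK₁ (hy.trans hρb')) (fun y hy => hv x y hxK₁ (hy.trans hρv'))
    (fun y hy => hry x y hx (hy.trans (by linarith)))
  rw [← hcx] at hKb
  have hMw : ∀ y ∈ latticeBall (boxCentre c (4 * (2 * q))) (2 * (2 * (4 * (2 * q))) + 1), |𝓕.Hw δ y| ≤ M := by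
    intro y hy
    rw [hcx] at hy
    have hd : dist (meshPoint δ y) (meshPoint δ x) ≤ ρ := by
      refine (dist_meshPoint_le_of_mem_latticeBall hδ0.le hy).trans (le_trans ?_ hR)
      gcongr; push_cast; linarith
    exact (hbd y (Metric.mem_cthickening_of_dist_le _ _ _ _ hx (hd.trans hρr))).1
  have hMb : ∀ y ∈ latticeBall (boxCentre c (4 * (2 * q))) (2 * (2 * (4 * (2 * q))) + 1), |𝓕.Hb δ y| ≤ M := by
    intro y hy
    rw [hcx] at hy
    have hd : dist (meshPoint δ y) (meshPoint δ x) ≤ ρ := by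
      refine (dist_meshPoint_le_of_mem_latticeBall hδ0.le hy).trans (le_trans ?_ hR)
      gcongr; push_cast; linarith
    exact (hbd y (Metric.mem_cthickening_of_dist_le _ _ _ _ hx (hd.trans hρr))).2
  have hyb : y ∈ latticeBall (boxCentre c (4 * (2 * q))) q := by rw [hcx]; exact hy
  have hKb' : KCBulkG (discreteDomainGraph Ω δ) (𝓕.Λ δ) (𝓕.cut δ) (𝓕.P δ) (sourcePlaq δ a)
      (latticeBall (boxCentre c (4 * (2 * q))) (2 * (2 * (4 * (2 * q))) + 3)) := by
    convert hKb using 2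
    push_cast; ring
  have key := norm_sub_seamGaugeS_le_of_gaugedBulk hprim hcuts hadj (discreteDomainGraph_le_zdGraph Ω δ) hq hKb' hM hMw hMb hyb
    (Or.inl rfl) j
  simp only [gobs]
  refine key.trans (le_of_eq ?_)
  have h2q0 : (0 : ℝ) < ((2 * q : ℕ) : ℝ) := by positivity
  have hsq : 0 < Real.sqrt ((2 * q : ℕ) : ℝ) := Real.sqrt_pos.2 h2q0
  field_simp

end KCFamily

end Literature.Probability.LatticeModels
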